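import Summits.QuantumFields.BalabanUV.Beta.FP.TorusNestedReadoutTranslateRows

/-!
# `BalabanUV.Beta.FP.TorusNestedReadoutReference` — road «FP», binder row D1, ROUTE T (β1), STUB P of the row's ONE file, (C) part 4 of 5 (J-NOTE-20 §8, R-AN2-76-PB's VALUE half):
# **THE NESTED-SLICE GAUGE READ-OUT `E·(N·W₀)⁻¹·N` OF TWO TOWERS AGREES ON CORRESPONDING BIG BLOCKS; THE `hlve`-SHAPED TREE-GAUGE READ-OUTS AT CORRESPONDING FINEST SITES
# AGREE WHEN THE COLUMNS AGREE ON THE CORRESPONDING INTRA-BLOCK BONDS** (generic `Q` under (TB) + (TQ); `det (N·W₀) ≠ 0` on both towers — leaf-06 G-2 twice)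

SETTING (parts 1–5 of (C)).  Two towers over top tori `M`, `M′` (`Lc ∣ M i`, `Lc ∣ M′ i`), same `Lc`, `lev`, `rs`, depth `n+1`; a block shift `v : Site (d+1)`: top sites move by
`Lc • v`, the finest sites by `bigRatio Lc (n+1) • v = Lc^(n+2) • v`; slots correspond («Corr») when the sites of `towerEquiv⁻¹` differ by that shift, finest bonds when their base
points do (same direction).  Objects as in parts (A1)(A2): `N := fromRows (τ₂·Q₁₀) τ₁` (letter `hN`), `Q₁₀ = compRowsG Lc Q M lev rs (n+1)` for a GENERIC `Q : StepRows d Lc`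
under the displayed letters (TB) (two-block support of non-wrapping rows) and (TQ) (block-translation covariance of non-wrapping rows:
`↑a′ = ↑a + Lc•v → ↑b′ = ↑b + Lc•(Lc•v) → ↑a + e_ν ∈ pbox M → ↑a′ + e_ν ∈ pbox M′ → Q M ℓ r (a,ν) (b,κ) = Q M′ ℓ r (a′,ν) (b′,κ)`), both discharged at the record's `QSym Lc`
(`FP/QstepSymTwoBlock`, `FP/QstepSymBlockTranslate`); `τ₁ = bigP` of the lower tower, `τ₂ = combF`, `W₀ = towerGen`, `E = towerEvalC`.

WHAT, this part ([folklore]; no `def`, no `def … : Prop`, nothing cited, 0 sorry, default heartbeats): §1 the slot correspondence is one-to-one (`corr_right_unique ∕ corr_left_unique`: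
sites determine slots) and ONTO between the blocks of an anchored pair (**`exists_corr`**: the moved site is a box point of the other tower — its block is the partner's, (A1)
`mem_pbox_of_quo_eq` — and a big-comb non-root, part 1 `ne_rootOf_add_zsmul_iff`); §2 **`inv_apply_corr`**: `(N·W₀)⁻¹ r q = (N′·W₀′)⁻¹ r′ q′` at corresponding slots (part 1 §0
`inv_apply_eq_of_block_rel` fed with (A2)'s block-diagonality `nestedRows_mul_towerGen_apply_eq_zero` on each tower, part 3's `nestedRows_mul_towerGen_apply_corr`, §1);
§3 **`readout_apply_corr`** (`(E·(N·W₀)⁻¹·N) p b = (E′·(N′·W₀′)⁻¹·N′) p′ b′` — both middle-slot sums re-indexed along the correspondence on their supports, which lie in `p`'s block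
by (A2) (L3) and the block-diagonal inverse; factors by part 2 `towerEvalC_apply_corr`, §2, part 3 `nestedRows_apply_corr`), `mulVec_eq_neg_readout_mulVec` (solving the
(D)-shaped equation), **`readout_mulVec_corr`** (columns agreeing on corresponding bonds INSIDE `p`'s block give equal read-outs at `p ↔ p′` — the bond sum re-indexed on the
support, which is intra-block by (A2) `readout_apply_ne_zero`), and **`treeGauge_readout_corr`**: from `det (N·W₀) ≠ 0`, `det (N′·W₀′) ≠ 0`, `(N·W₀)·θ = −N·X`,
`(N′·W₀′)·θ′ = −N′·X′` ((D) §2's shape on each tower), finest sites `↑s′ = ↑s + bigRatio•v` and `X b = X′ b′` for corresponding bonds with both endpoints in `s`'s big block: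
`Σ_x [x.1 = s]·(E *ᵥ θ)(towerEquiv x) = Σ_x′ [x′.1 = s′]·(E′ *ᵥ θ′)(towerEquiv′ x′)` — v10's `hlve` word on the box `M` IS the same word on the box `M′`.  Part 5 discharges
(TB)(TQ) at the record's `compRowsSym`; with `M′ := fun _ => Lc` (one big block; `Lc ∣ Lc`) this is J-NOTE-20 §8's «general-box read-out = reference read-out on each block»,
so (P-c)'s `λℤ` can be DEFINED through the reference torus's finite objects and its `Mc B`-periodisation identity reduces to PART 47-style unwrapping of the column.
WHAT THIS IS NOT: not (P-c) itself (the lattice `λℤ` as a `def`, its `Mc B`-periodisation = `lv` — the row's, on top of this identity); `hlve` NOT instantiated; no row of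
v9∕v10 discharged; nothing of Bałaban's asserted, valued or discharged; 0 estimates; 0∕4 row-D1 binders (hW, hR, D1Tel, D1Rep); ROOT M‴ p325680 untouched; NOT (C1), NOT (L2′),
NOT (T-ID), NOT SDF, NOT D1, NEVER «G-an2-4 closed», NOT BetaPertH, NOT continuum, NOT Clay.

HONEST DEPENDENCY (page 1, mandatory): continuum YM on T⁴ ⇐ BetaPertH ∧ nine spine estimates (0/9 proved); BetaPertH ⇐ (D1) ∧ (D4) ∧ CAP+tail;
G-an2-4 gates asym, D1 and NE2/3/4.  HONEST FRAMING (cell contract, verbatim): «discharging `BetaPertH` makes Bałaban's UV stability UNCONDITIONAL —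
a real constructive-QFT result; it is NOT the continuum limit and NOT the Clay problem.»  ABSOLUTE RULE (cell charter, verbatim): «No internally-minted
statement may enter as a cited fact. Every hypothesis is either kernel-proved in this package or a verbatim quotation of a PUBLISHED theorem with page
reference. The manuscript(s) under audit are NOT citable for their own disputed steps — they are the thing under adjudication; programme-internal
(2001/route/tribunal) claims are never citable.»  Road «FP» OWNER, b2b-balaban-beta-d1-p3 gen 54, 2026-08-29.  No existing file touched.
-/

noncomputable section

namespace Summit.QuantumFields.BalabanUV.Beta.FP.TorusNestedReadoutReference

open Matrix Finset
open scoped BigOperators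
open Literature.MathematicalPhysics.QuantumFieldTheory
open Literature.MathematicalPhysics.QuantumFieldTheory.Balaban1983to89
open Literature.MathematicalPhysics.QuantumFieldTheory.Balaban1983to89.Beta
open B5Prop11Plancherel (fine)
open B6Lemma24Torus (pbox mem_pbox)
open AffineAveraging (Site toSite unitVec)
open OneStepResolventKernel (Fib)
open Literature.MathematicalPhysics.QuantumFieldTheory.LatticeForm (quo)
open Summit.QuantumFields.BalabanUV.Beta.FP.KernelPeriodisationFib (Idx)
open Summit.QuantumFields.BalabanUV.Beta.FP.TorusCombForest
open Summit.QuantumFields.BalabanUV.Beta.FP.TorusCombRows (Res)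
open Summit.QuantumFields.BalabanUV.Beta.FP.TorusCombNestedBasis (quo_lift quo_mem_pbox)
open Summit.QuantumFields.BalabanUV.Beta.FP.TorusCompositeObjects
open Summit.QuantumFields.BalabanUV.Beta.FP.TorusCompositeObjectsG (StepRows compRowsG)
open Summit.QuantumFields.BalabanUV.Beta.FP.TorusCompositeUnimodular (towerEvalC bigRatio_dvd_towerTorus)
open Summit.QuantumFields.BalabanUV.Beta.FP.TorusNestedReadoutRows
open Summit.QuantumFields.BalabanUV.Beta.FP.TorusNestedReadoutLocality
open Summit.QuantumFields.BalabanUV.Beta.FP.TorusCombTranslate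
open Summit.QuantumFields.BalabanUV.Beta.FP.TorusNestedReadoutTranslate
open Summit.QuantumFields.BalabanUV.Beta.FP.TorusNestedReadoutTranslateRows

variable {d : ℕ}

/-! ## §1 The slot correspondence «site′ = site + bigRatio•v» is one-to-one and onto between corresponding big blocks -/

section Slots

variable (Lc : ℕ) [NeZero Lc] (M M' : Fin (d + 1) → ℕ) (rs : ℕ → (Fin (d + 1) → ℕ)) (hrs : ∀ k i, 0 ≤ toSite (rs k) i ∧ toSite (rs k) i < (Lc : ℤ))
  (hM' : ∀ i, Lc ∣ M' i) (n : ℕ) (v : Site (d + 1))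
include hM'

omit hM' in
/-- [folklore] a slot has at most one partner. -/
theorem corr_right_unique (p : NParam Lc M rs (n + 1)) (p' q' : NParam Lc M' rs (n + 1))
    (hp : ((towerEquiv Lc M' rs hrs (n + 1)).symm p').site = ((towerEquiv Lc M rs hrs (n + 1)).symm p).site + ((bigRatio Lc (n + 1) : ℕ) : ℤ) • v)
    (hq : ((towerEquiv Lc M' rs hrs (n + 1)).symm q').site = ((towerEquiv Lc M rs hrs (n + 1)).symm p).site + ((bigRatio Lc (n + 1) : ℕ) : ℤ) • v) :
    p' = q' :=
  (towerEquiv Lc M' rs hrs (n + 1)).symm.injective ((Res.ext_iff' _ _).2 (hp.trans hq.symm))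

omit hM' in
/-- [folklore] a slot is the partner of at most one slot. -/
theorem corr_left_unique (p q : NParam Lc M rs (n + 1)) (p' : NParam Lc M' rs (n + 1))
    (hp : ((towerEquiv Lc M' rs hrs (n + 1)).symm p').site = ((towerEquiv Lc M rs hrs (n + 1)).symm p).site + ((bigRatio Lc (n + 1) : ℕ) : ℤ) • v)
    (hq : ((towerEquiv Lc M' rs hrs (n + 1)).symm p').site = ((towerEquiv Lc M rs hrs (n + 1)).symm q).site + ((bigRatio Lc (n + 1) : ℕ) : ℤ) • v) :
    p = q :=
  (towerEquiv Lc M rs hrs (n + 1)).symm.injective ((Res.ext_iff' _ _).2 (add_right_cancel (hp.symm.trans hq)))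

/-- [folklore] **EVERY SLOT OF AN ANCHORED BLOCK HAS A PARTNER**: if `p ↔ p′` correspond, every slot `x` of `p`'s big block has a partner `x′` (the moved site is a box point of the
other tower — its block is `p′`'s — and a big-comb non-root). -/
theorem exists_corr (p : NParam Lc M rs (n + 1)) (p' : NParam Lc M' rs (n + 1))
    (hp : ((towerEquiv Lc M' rs hrs (n + 1)).symm p').site = ((towerEquiv Lc M rs hrs (n + 1)).symm p).site + ((bigRatio Lc (n + 1) : ℕ) : ℤ) • v)
    (x : NParam Lc M rs (n + 1))
    (hx : quo (bigRatio Lc (n + 1)) ((towerEquiv Lc M rs hrs (n + 1)).symm x).site = quo (bigRatio Lc (n + 1)) ((towerEquiv Lc M rs hrs (n + 1)).symm p).site) :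
    ∃ x' : NParam Lc M' rs (n + 1),
      ((towerEquiv Lc M' rs hrs (n + 1)).symm x').site = ((towerEquiv Lc M rs hrs (n + 1)).symm x).site + ((bigRatio Lc (n + 1) : ℕ) : ℤ) • v := by
  have hLc : 0 < Lc := Nat.pos_of_ne_zero (NeZero.ne Lc)
  have hL : 0 < bigRatio Lc (n + 1) := bigRatio_pos Lc hLc (n + 1)
  have hmem : ((towerEquiv Lc M rs hrs (n + 1)).symm x).site + ((bigRatio Lc (n + 1) : ℕ) : ℤ) • v ∈ pbox (towerTorus Lc M' (n + 1)) :=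
    mem_pbox_of_quo_eq hL (bigRatio_dvd_towerTorus Lc hM' (n + 1)) ((towerEquiv Lc M' rs hrs (n + 1)).symm p').mem
      (by rw [quo_add_zsmul hL, hx, hp, quo_add_zsmul hL])
  have hnr : ((towerEquiv Lc M rs hrs (n + 1)).symm x).site + ((bigRatio Lc (n + 1) : ℕ) : ℤ) • v
      ≠ rootOf (bigRoot Lc rs (n + 1)) (bigRatio Lc (n + 1)) (((towerEquiv Lc M rs hrs (n + 1)).symm x).site + ((bigRatio Lc (n + 1) : ℕ) : ℤ) • v) :=
    (ne_rootOf_add_zsmul_iff hL _ v).2 ((towerEquiv Lc M rs hrs (n + 1)).symm x).not_root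
  exact ⟨towerEquiv Lc M' rs hrs (n + 1) ⟨⟨_, hmem⟩, hnr⟩, by rw [Equiv.symm_apply_apply]⟩

end Slots

/-! ## §2 The inverse blocks agree -/

section Inverse

variable (Lc : ℕ) [NeZero Lc] (Q : StepRows d Lc)
  (hQ : ∀ (M : Fin (d + 1) → ℕ) [∀ μ, NeZero (M μ)] (ℓ : ℕ) (r : Fin (d + 1) → ℕ) (a : ↥(pbox M)) (ν : Fin (d + 1))
      (b : ↥(pbox (fine Lc M))) (κ : Fin (d + 1)),
      (a : Site (d + 1)) + unitVec ν ∈ pbox M → Q M ℓ r (a, ν) (b, κ) ≠ 0 →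
        (quo Lc (b : Site (d + 1)) = a ∨ quo Lc (b : Site (d + 1)) = (a : Site (d + 1)) + unitVec ν) ∧
        (quo Lc ((b : Site (d + 1)) + unitVec κ) = a ∨ quo Lc ((b : Site (d + 1)) + unitVec κ) = (a : Site (d + 1)) + unitVec ν))
  (hQt : ∀ (M M' : Fin (d + 1) → ℕ) [∀ μ, NeZero (M μ)] [∀ μ, NeZero (M' μ)] (ℓ : ℕ) (r : Fin (d + 1) → ℕ) (v : Site (d + 1))
      (a : ↥(pbox M)) (a' : ↥(pbox M')) (ν : Fin (d + 1)) (b : ↥(pbox (fine Lc M))) (b' : ↥(pbox (fine Lc M'))) (κ : Fin (d + 1)),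
      (a' : Site (d + 1)) = (a : Site (d + 1)) + (Lc : ℤ) • v → (b' : Site (d + 1)) = (b : Site (d + 1)) + (Lc : ℤ) • ((Lc : ℤ) • v) →
      (a : Site (d + 1)) + unitVec ν ∈ pbox M → (a' : Site (d + 1)) + unitVec ν ∈ pbox M' →
        Q M ℓ r (a, ν) (b, κ) = Q M' ℓ r (a', ν) (b', κ))
  (M M' : Fin (d + 1) → ℕ) [∀ μ, NeZero (M μ)] [∀ μ, NeZero (M' μ)] (lev : ℕ → ℕ) (rs : ℕ → (Fin (d + 1) → ℕ))
  (hrs : ∀ k i, 0 ≤ toSite (rs k) i ∧ toSite (rs k) i < (Lc : ℤ)) (hM : ∀ i, Lc ∣ M i) (hM' : ∀ i, Lc ∣ M' i) (n : ℕ) (v : Site (d + 1))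
include hQ hQt hM hM'

/-- [folklore] **THE INVERSE OF `N·W₀` AT CORRESPONDING SLOTS AGREES** (`det ≠ 0` on both towers — leaf-06 G-2 twice): on different blocks both vanish (block-diagonality and its
inverse form); on one block, the slot correspondence is an equivalence of the two blocks carrying `N·W₀` to `N′·W₀′` (part 3), and the inverse of a block-diagonal matrix
restricted to a block is the inverse of the block (part 1 §0). -/
theorem inv_apply_corr
    {Q₁₀ : Matrix (↥(pbox M) × Fin (d + 1)) (↥(pbox (towerTorus Lc M (n + 1))) × Fin (d + 1)) ℝ} (hQ₁₀ : Q₁₀ = compRowsG Lc Q M lev rs (n + 1))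
    {τ₁ : Matrix (NParam Lc (fine Lc M) (fun k => rs (k + 1)) n) (↥(pbox (towerTorus Lc M (n + 1))) × Fin (d + 1)) ℝ}
    (hτ₁ : τ₁ = bigP Lc (fine Lc M) (fun k => rs (k + 1)) (fun k => hrs (k + 1)) n)
    {τ₂ : Matrix (Res (toSite (rs 0)) Lc M) (↥(pbox M) × Fin (d + 1)) ℝ} (hτ₂ : τ₂ = combF Lc M (rs 0))
    {N : Matrix (NParam Lc M rs (n + 1)) (↥(pbox (towerTorus Lc M (n + 1))) × Fin (d + 1)) ℝ} (hN : N = Matrix.fromRows (τ₂ * Q₁₀) τ₁)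
    {W₀ : Matrix (↥(pbox (towerTorus Lc M (n + 1))) × Fin (d + 1)) (NParam Lc M rs (n + 1)) ℝ} (hW₀ : W₀ = towerGen Lc M rs (n + 1))
    {Q₁₀' : Matrix (↥(pbox M') × Fin (d + 1)) (↥(pbox (towerTorus Lc M' (n + 1))) × Fin (d + 1)) ℝ} (hQ₁₀' : Q₁₀' = compRowsG Lc Q M' lev rs (n + 1))
    {τ₁' : Matrix (NParam Lc (fine Lc M') (fun k => rs (k + 1)) n) (↥(pbox (towerTorus Lc M' (n + 1))) × Fin (d + 1)) ℝ}
    (hτ₁' : τ₁' = bigP Lc (fine Lc M') (fun k => rs (k + 1)) (fun k => hrs (k + 1)) n)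
    {τ₂' : Matrix (Res (toSite (rs 0)) Lc M') (↥(pbox M') × Fin (d + 1)) ℝ} (hτ₂' : τ₂' = combF Lc M' (rs 0))
    {N' : Matrix (NParam Lc M' rs (n + 1)) (↥(pbox (towerTorus Lc M' (n + 1))) × Fin (d + 1)) ℝ} (hN' : N' = Matrix.fromRows (τ₂' * Q₁₀') τ₁')
    {W₀' : Matrix (↥(pbox (towerTorus Lc M' (n + 1))) × Fin (d + 1)) (NParam Lc M' rs (n + 1)) ℝ} (hW₀' : W₀' = towerGen Lc M' rs (n + 1))
    (hTW : (N * W₀).det ≠ 0) (hTW' : (N' * W₀').det ≠ 0)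
    (r q : NParam Lc M rs (n + 1)) (r' q' : NParam Lc M' rs (n + 1))
    (hr : ((towerEquiv Lc M' rs hrs (n + 1)).symm r').site = ((towerEquiv Lc M rs hrs (n + 1)).symm r).site + ((bigRatio Lc (n + 1) : ℕ) : ℤ) • v)
    (hq : ((towerEquiv Lc M' rs hrs (n + 1)).symm q').site = ((towerEquiv Lc M rs hrs (n + 1)).symm q).site + ((bigRatio Lc (n + 1) : ℕ) : ℤ) • v) :
    (N * W₀)⁻¹ r q = (N' * W₀')⁻¹ r' q' := by
  have hLc : 0 < Lc := Nat.pos_of_ne_zero (NeZero.ne Lc)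
  have hL : 0 < bigRatio Lc (n + 1) := bigRatio_pos Lc hLc (n + 1)
  refine inv_apply_eq_of_block_rel (N * W₀) (N' * W₀') (isUnit_iff_ne_zero.mpr hTW) (isUnit_iff_ne_zero.mpr hTW')
    (fun x => quo (bigRatio Lc (n + 1)) ((towerEquiv Lc M rs hrs (n + 1)).symm x).site)
    (fun x' => quo (bigRatio Lc (n + 1)) ((towerEquiv Lc M' rs hrs (n + 1)).symm x').site)
    (fun x x' => ((towerEquiv Lc M' rs hrs (n + 1)).symm x').site = ((towerEquiv Lc M rs hrs (n + 1)).symm x).site + ((bigRatio Lc (n + 1) : ℕ) : ℤ) • v)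
    (fun x x' y' hx hy => corr_right_unique Lc M M' rs hrs n v x x' y' hx hy)
    (fun x y x' hx hy => corr_left_unique Lc M M' rs hrs n v x y x' hx hy)
    (fun x y hxy => nestedRows_mul_towerGen_apply_eq_zero Lc Q hQ M lev rs hrs hM n hQ₁₀ hτ₁ hτ₂ hN hW₀ x y hxy)
    (fun x y hxy => nestedRows_mul_towerGen_apply_eq_zero Lc Q hQ M' lev rs hrs hM' n hQ₁₀' hτ₁' hτ₂' hN' hW₀' x y hxy)
    (fun x y x' y' hx hy => nestedRows_mul_towerGen_apply_corr Lc Q hQ hQt M M' lev rs hrs hM hM' n v hQ₁₀ hτ₁ hτ₂ hN hW₀ hQ₁₀' hτ₁' hτ₂' hN' hW₀' x y x' y' hx hy)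
    (fun x y x' y' hx hy => ?_) r q r' q' hr hq (fun x hx => exists_corr Lc M M' rs hrs hM' n v r r' hr x hx) (fun x' hx' => ?_)
  · rw [quo_corr Lc M M' rs hrs n v x x' hx, quo_corr Lc M M' rs hrs n v y y' hy, add_left_inj]
  · -- partners backwards: the reverse correspondence anchored at `r' ↔ r`
    have hr' : ((towerEquiv Lc M rs hrs (n + 1)).symm r).site = ((towerEquiv Lc M' rs hrs (n + 1)).symm r').site + ((bigRatio Lc (n + 1) : ℕ) : ℤ) • (-v) := by
      rw [hr, smul_neg, add_neg_cancel_right]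
    obtain ⟨x, hx⟩ := exists_corr Lc M' M rs hrs hM n (-v) r' r hr' x' hx'
    exact ⟨x, by rw [hx, smul_neg, neg_add_cancel_right]⟩

/-! ## §3 The read-out entries and the tree-gauge read-outs at corresponding slots ∕ sites agree -/

/-- [folklore] **THE READ-OUT `E·(N·W₀)⁻¹·N` AT CORRESPONDING SLOTS AND BONDS AGREES** — both finite sums (over the middle slots) re-indexed along the slot correspondence on their
supports (supports lie in the slot's big block by (L3) and the block-diagonal inverse; partners exist there by §1), the factors agreeing by `towerEvalC_apply_corr`, §2 and
`nestedRows_apply_corr`. -/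
theorem readout_apply_corr
    {Q₁₀ : Matrix (↥(pbox M) × Fin (d + 1)) (↥(pbox (towerTorus Lc M (n + 1))) × Fin (d + 1)) ℝ} (hQ₁₀ : Q₁₀ = compRowsG Lc Q M lev rs (n + 1))
    {τ₁ : Matrix (NParam Lc (fine Lc M) (fun k => rs (k + 1)) n) (↥(pbox (towerTorus Lc M (n + 1))) × Fin (d + 1)) ℝ}
    (hτ₁ : τ₁ = bigP Lc (fine Lc M) (fun k => rs (k + 1)) (fun k => hrs (k + 1)) n)
    {τ₂ : Matrix (Res (toSite (rs 0)) Lc M) (↥(pbox M) × Fin (d + 1)) ℝ} (hτ₂ : τ₂ = combF Lc M (rs 0))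
    {N : Matrix (NParam Lc M rs (n + 1)) (↥(pbox (towerTorus Lc M (n + 1))) × Fin (d + 1)) ℝ} (hN : N = Matrix.fromRows (τ₂ * Q₁₀) τ₁)
    {W₀ : Matrix (↥(pbox (towerTorus Lc M (n + 1))) × Fin (d + 1)) (NParam Lc M rs (n + 1)) ℝ} (hW₀ : W₀ = towerGen Lc M rs (n + 1))
    {E : Matrix (NParam Lc M rs (n + 1)) (NParam Lc M rs (n + 1)) ℝ} (hE : E = towerEvalC Lc M rs hrs (n + 1))
    {Q₁₀' : Matrix (↥(pbox M') × Fin (d + 1)) (↥(pbox (towerTorus Lc M' (n + 1))) × Fin (d + 1)) ℝ} (hQ₁₀' : Q₁₀' = compRowsG Lc Q M' lev rs (n + 1))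
    {τ₁' : Matrix (NParam Lc (fine Lc M') (fun k => rs (k + 1)) n) (↥(pbox (towerTorus Lc M' (n + 1))) × Fin (d + 1)) ℝ}
    (hτ₁' : τ₁' = bigP Lc (fine Lc M') (fun k => rs (k + 1)) (fun k => hrs (k + 1)) n)
    {τ₂' : Matrix (Res (toSite (rs 0)) Lc M') (↥(pbox M') × Fin (d + 1)) ℝ} (hτ₂' : τ₂' = combF Lc M' (rs 0))
    {N' : Matrix (NParam Lc M' rs (n + 1)) (↥(pbox (towerTorus Lc M' (n + 1))) × Fin (d + 1)) ℝ} (hN' : N' = Matrix.fromRows (τ₂' * Q₁₀') τ₁')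
    {W₀' : Matrix (↥(pbox (towerTorus Lc M' (n + 1))) × Fin (d + 1)) (NParam Lc M' rs (n + 1)) ℝ} (hW₀' : W₀' = towerGen Lc M' rs (n + 1))
    {E' : Matrix (NParam Lc M' rs (n + 1)) (NParam Lc M' rs (n + 1)) ℝ} (hE' : E' = towerEvalC Lc M' rs hrs (n + 1))
    (hTW : (N * W₀).det ≠ 0) (hTW' : (N' * W₀').det ≠ 0)
    (p : NParam Lc M rs (n + 1)) (p' : NParam Lc M' rs (n + 1))
    (hp : ((towerEquiv Lc M' rs hrs (n + 1)).symm p').site = ((towerEquiv Lc M rs hrs (n + 1)).symm p).site + ((bigRatio Lc (n + 1) : ℕ) : ℤ) • v)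
    (b : ↥(pbox (towerTorus Lc M (n + 1))) × Fin (d + 1)) (b' : ↥(pbox (towerTorus Lc M' (n + 1))) × Fin (d + 1))
    (hb : (b'.1 : Site (d + 1)) = (b.1 : Site (d + 1)) + ((bigRatio Lc (n + 1) : ℕ) : ℤ) • v) (hb2 : b'.2 = b.2) :
    (E * (N * W₀)⁻¹ * N) p b = (E' * (N' * W₀')⁻¹ * N') p' b' := by
  have hLc : 0 < Lc := Nat.pos_of_ne_zero (NeZero.ne Lc)
  have hL : 0 < bigRatio Lc (n + 1) := bigRatio_pos Lc hLc (n + 1)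
  -- the reverse anchor
  have hp' : ((towerEquiv Lc M rs hrs (n + 1)).symm p).site = ((towerEquiv Lc M' rs hrs (n + 1)).symm p').site + ((bigRatio Lc (n + 1) : ℕ) : ℤ) • (-v) := by
    rw [hp, smul_neg, add_neg_cancel_right]
  -- blocks of related slots
  have hblk : ∀ (x : NParam Lc M rs (n + 1)) (x' : NParam Lc M' rs (n + 1)),
      ((towerEquiv Lc M' rs hrs (n + 1)).symm x').site = ((towerEquiv Lc M rs hrs (n + 1)).symm x).site + ((bigRatio Lc (n + 1) : ℕ) : ℤ) • v →
      (quo (bigRatio Lc (n + 1)) ((towerEquiv Lc M rs hrs (n + 1)).symm x).site = quo (bigRatio Lc (n + 1)) ((towerEquiv Lc M rs hrs (n + 1)).symm p).site ↔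
        quo (bigRatio Lc (n + 1)) ((towerEquiv Lc M' rs hrs (n + 1)).symm x').site = quo (bigRatio Lc (n + 1)) ((towerEquiv Lc M' rs hrs (n + 1)).symm p').site) := by
    intro x x' hx
    rw [quo_corr Lc M M' rs hrs n v x x' hx, quo_corr Lc M M' rs hrs n v p p' hp, add_left_inj]
  -- the inner product `(E·A⁻¹) x q` at related pairs
  have inner : ∀ (q : NParam Lc M rs (n + 1)) (q' : NParam Lc M' rs (n + 1)),
      ((towerEquiv Lc M' rs hrs (n + 1)).symm q').site = ((towerEquiv Lc M rs hrs (n + 1)).symm q).site + ((bigRatio Lc (n + 1) : ℕ) : ℤ) • v →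
        (E * (N * W₀)⁻¹) p q = (E' * (N' * W₀')⁻¹) p' q' := by
    intro q q' hq
    rw [Matrix.mul_apply, Matrix.mul_apply]
    refine sum_eq_sum_of_rel _ _
      (fun x x' => ((towerEquiv Lc M' rs hrs (n + 1)).symm x').site = ((towerEquiv Lc M rs hrs (n + 1)).symm x).site + ((bigRatio Lc (n + 1) : ℕ) : ℤ) • v)
      (fun x x' y' hx hy => corr_right_unique Lc M M' rs hrs n v x x' y' hx hy)
      (fun x y x' hx hy => corr_left_unique Lc M M' rs hrs n v x y x' hx hy)
      (fun x hne => exists_corr Lc M M' rs hrs hM' n v p p' hp x ?_)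
      (fun x' hne => ?_) (fun x x' hx => ?_)
    · exact (towerEvalC_apply_ne_zero Lc (n + 1) M rs hrs p x (by rw [hE] at hne; exact left_ne_zero_of_mul hne)).symm
    · have hx' := (towerEvalC_apply_ne_zero Lc (n + 1) M' rs hrs p' x' (by rw [hE'] at hne; exact left_ne_zero_of_mul hne)).symm
      obtain ⟨x, hx⟩ := exists_corr Lc M' M rs hrs hM n (-v) p' p hp' x' hx'
      exact ⟨x, by rw [hx, smul_neg, neg_add_cancel_right]⟩
    · rw [hE, hE', towerEvalC_apply_corr Lc (n + 1) M M' rs hrs v p x p' x' hp hx,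
        inv_apply_corr Lc Q hQ hQt M M' lev rs hrs hM hM' n v hQ₁₀ hτ₁ hτ₂ hN hW₀ hQ₁₀' hτ₁' hτ₂' hN' hW₀' hTW hTW' x q x' q' hx hq]
  rw [Matrix.mul_apply, Matrix.mul_apply]
  refine sum_eq_sum_of_rel _ _
    (fun x x' => ((towerEquiv Lc M' rs hrs (n + 1)).symm x').site = ((towerEquiv Lc M rs hrs (n + 1)).symm x).site + ((bigRatio Lc (n + 1) : ℕ) : ℤ) • v)
    (fun x x' y' hx hy => corr_right_unique Lc M M' rs hrs n v x x' y' hx hy)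
    (fun x y x' hx hy => corr_left_unique Lc M M' rs hrs n v x y x' hx hy)
    (fun q hne => exists_corr Lc M M' rs hrs hM' n v p p' hp q ?_)
    (fun q' hne => ?_) (fun q q' hq => ?_)
  · -- a nonzero outer term: `(E·A⁻¹) p q ≠ 0`, so some `E p x ≠ 0 ≠ A⁻¹ x q`: `q`, `x`, `p` share their block
    obtain ⟨x, h1, h2⟩ := exists_of_mul_apply_ne_zero _ _ _ _ (left_ne_zero_of_mul hne)
    have ex := towerEvalC_apply_ne_zero Lc (n + 1) M rs hrs p x (by rw [hE] at h1; exact h1)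
    by_contra hne'
    exact h2 (inv_apply_eq_zero_of_blockDiagonal (fun y => quo (bigRatio Lc (n + 1)) ((towerEquiv Lc M rs hrs (n + 1)).symm y).site) _
      (fun y z hyz => nestedRows_mul_towerGen_apply_eq_zero Lc Q hQ M lev rs hrs hM n hQ₁₀ hτ₁ hτ₂ hN hW₀ y z hyz) x q (by rw [← ex]; exact Ne.symm hne'))
  · obtain ⟨x', h1, h2⟩ := exists_of_mul_apply_ne_zero _ _ _ _ (left_ne_zero_of_mul hne)
    have ex := towerEvalC_apply_ne_zero Lc (n + 1) M' rs hrs p' x' (by rw [hE'] at h1; exact h1)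
    have hq'blk : quo (bigRatio Lc (n + 1)) ((towerEquiv Lc M' rs hrs (n + 1)).symm q').site = quo (bigRatio Lc (n + 1)) ((towerEquiv Lc M' rs hrs (n + 1)).symm p').site := by
      by_contra hne'
      exact h2 (inv_apply_eq_zero_of_blockDiagonal (fun y => quo (bigRatio Lc (n + 1)) ((towerEquiv Lc M' rs hrs (n + 1)).symm y).site) _
        (fun y z hyz => nestedRows_mul_towerGen_apply_eq_zero Lc Q hQ M' lev rs hrs hM' n hQ₁₀' hτ₁' hτ₂' hN' hW₀' y z hyz) x' q' (by rw [← ex]; exact Ne.symm hne'))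
    obtain ⟨q, hq⟩ := exists_corr Lc M' M rs hrs hM n (-v) p' p hp' q' hq'blk
    exact ⟨q, by rw [hq, smul_neg, neg_add_cancel_right]⟩
  · have eN : N q b = N' q' b' := by
      rw [hN, hN', hτ₂, hQ₁₀, hτ₁, hτ₂', hQ₁₀', hτ₁']
      exact nestedRows_apply_corr Lc Q hQ hQt M M' lev rs hrs hM hM' n v q q' hq b b' hb hb2
    rw [inner q q' hq, eN]

omit hQ hQt hM hM' in
/-- [folklore] solving the (D)-shaped equation: `det A ≠ 0`, `A·t = −Nm·Y ⟹ Em·t = −(Em·A⁻¹·Nm)·Y`. -/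
theorem mulVec_eq_neg_readout_mulVec {ι σ : Type*} [Fintype ι] [DecidableEq ι] [Fintype σ] (A Em : Matrix ι ι ℝ) (Nm : Matrix ι σ ℝ) (hu : IsUnit A.det)
    {t : ι → ℝ} {Y : σ → ℝ} (ht : A *ᵥ t = -(Nm *ᵥ Y)) : Em *ᵥ t = -((Em * A⁻¹ * Nm) *ᵥ Y) := by
  have e : t = -(A⁻¹ *ᵥ (Nm *ᵥ Y)) := by
    rw [← Matrix.mulVec_neg, ← ht, Matrix.mulVec_mulVec, Matrix.nonsing_inv_mul _ hu, Matrix.one_mulVec]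
  rw [e, Matrix.mulVec_neg, ← Matrix.mulVec_mulVec, ← Matrix.mulVec_mulVec]

/-- [folklore] **THE READ-OUT APPLIED TO COLUMNS AGREEING ON CORRESPONDING INTRA-BLOCK BONDS AGREES AT CORRESPONDING SLOTS**:
`((E·(N·W₀)⁻¹·N) *ᵥ X) p = ((E′·(N′·W₀′)⁻¹·N′) *ᵥ X′) p′`. -/
theorem readout_mulVec_corr
    {Q₁₀ : Matrix (↥(pbox M) × Fin (d + 1)) (↥(pbox (towerTorus Lc M (n + 1))) × Fin (d + 1)) ℝ} (hQ₁₀ : Q₁₀ = compRowsG Lc Q M lev rs (n + 1))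
    {τ₁ : Matrix (NParam Lc (fine Lc M) (fun k => rs (k + 1)) n) (↥(pbox (towerTorus Lc M (n + 1))) × Fin (d + 1)) ℝ}
    (hτ₁ : τ₁ = bigP Lc (fine Lc M) (fun k => rs (k + 1)) (fun k => hrs (k + 1)) n)
    {τ₂ : Matrix (Res (toSite (rs 0)) Lc M) (↥(pbox M) × Fin (d + 1)) ℝ} (hτ₂ : τ₂ = combF Lc M (rs 0))
    {N : Matrix (NParam Lc M rs (n + 1)) (↥(pbox (towerTorus Lc M (n + 1))) × Fin (d + 1)) ℝ} (hN : N = Matrix.fromRows (τ₂ * Q₁₀) τ₁)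
    {W₀ : Matrix (↥(pbox (towerTorus Lc M (n + 1))) × Fin (d + 1)) (NParam Lc M rs (n + 1)) ℝ} (hW₀ : W₀ = towerGen Lc M rs (n + 1))
    {E : Matrix (NParam Lc M rs (n + 1)) (NParam Lc M rs (n + 1)) ℝ} (hE : E = towerEvalC Lc M rs hrs (n + 1))
    {Q₁₀' : Matrix (↥(pbox M') × Fin (d + 1)) (↥(pbox (towerTorus Lc M' (n + 1))) × Fin (d + 1)) ℝ} (hQ₁₀' : Q₁₀' = compRowsG Lc Q M' lev rs (n + 1))
    {τ₁' : Matrix (NParam Lc (fine Lc M') (fun k => rs (k + 1)) n) (↥(pbox (towerTorus Lc M' (n + 1))) × Fin (d + 1)) ℝ}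
    (hτ₁' : τ₁' = bigP Lc (fine Lc M') (fun k => rs (k + 1)) (fun k => hrs (k + 1)) n)
    {τ₂' : Matrix (Res (toSite (rs 0)) Lc M') (↥(pbox M') × Fin (d + 1)) ℝ} (hτ₂' : τ₂' = combF Lc M' (rs 0))
    {N' : Matrix (NParam Lc M' rs (n + 1)) (↥(pbox (towerTorus Lc M' (n + 1))) × Fin (d + 1)) ℝ} (hN' : N' = Matrix.fromRows (τ₂' * Q₁₀') τ₁')
    {W₀' : Matrix (↥(pbox (towerTorus Lc M' (n + 1))) × Fin (d + 1)) (NParam Lc M' rs (n + 1)) ℝ} (hW₀' : W₀' = towerGen Lc M' rs (n + 1))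
    {E' : Matrix (NParam Lc M' rs (n + 1)) (NParam Lc M' rs (n + 1)) ℝ} (hE' : E' = towerEvalC Lc M' rs hrs (n + 1))
    (hTW : (N * W₀).det ≠ 0) (hTW' : (N' * W₀').det ≠ 0)
    (p : NParam Lc M rs (n + 1)) (p' : NParam Lc M' rs (n + 1))
    (hp : ((towerEquiv Lc M' rs hrs (n + 1)).symm p').site = ((towerEquiv Lc M rs hrs (n + 1)).symm p).site + ((bigRatio Lc (n + 1) : ℕ) : ℤ) • v)
    (X : ↥(pbox (towerTorus Lc M (n + 1))) × Fin (d + 1) → ℝ) (X' : ↥(pbox (towerTorus Lc M' (n + 1))) × Fin (d + 1) → ℝ)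
    (hX : ∀ (b : ↥(pbox (towerTorus Lc M (n + 1))) × Fin (d + 1)) (b' : ↥(pbox (towerTorus Lc M' (n + 1))) × Fin (d + 1)),
      (b'.1 : Site (d + 1)) = (b.1 : Site (d + 1)) + ((bigRatio Lc (n + 1) : ℕ) : ℤ) • v → b'.2 = b.2 →
      quo (bigRatio Lc (n + 1)) (b.1 : Site (d + 1)) = quo (bigRatio Lc (n + 1)) ((towerEquiv Lc M rs hrs (n + 1)).symm p).site →
      quo (bigRatio Lc (n + 1)) ((b.1 : Site (d + 1)) + unitVec b.2) = quo (bigRatio Lc (n + 1)) ((towerEquiv Lc M rs hrs (n + 1)).symm p).site → X b = X' b') :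
    ((E * (N * W₀)⁻¹ * N) *ᵥ X) p = ((E' * (N' * W₀')⁻¹ * N') *ᵥ X') p' := by
  have hLc : 0 < Lc := Nat.pos_of_ne_zero (NeZero.ne Lc)
  have hL : 0 < bigRatio Lc (n + 1) := bigRatio_pos Lc hLc (n + 1)
  have hp' : ((towerEquiv Lc M rs hrs (n + 1)).symm p).site = ((towerEquiv Lc M' rs hrs (n + 1)).symm p').site + ((bigRatio Lc (n + 1) : ℕ) : ℤ) • (-v) := by
    rw [hp, smul_neg, add_neg_cancel_right]
  simp only [Matrix.mulVec, dotProduct]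
  refine sum_eq_sum_of_rel _ _
    (fun b b' => (b'.1 : Site (d + 1)) = (b.1 : Site (d + 1)) + ((bigRatio Lc (n + 1) : ℕ) : ℤ) • v ∧ b'.2 = b.2)
    (fun b i' j' hi hj => Prod.ext (Subtype.ext (hi.1.trans hj.1.symm)) (hi.2.trans hj.2.symm))
    (fun b₁ b₂ b' h₁ h₂ => Prod.ext (Subtype.ext (add_right_cancel (h₁.1.symm.trans h₂.1))) (h₁.2.symm.trans h₂.2))
    (fun b hne => ?_) (fun b' hne => ?_) (fun b b' hR => ?_)
  · obtain ⟨h1, _⟩ := readout_apply_ne_zero Lc Q hQ M lev rs hrs hM n hQ₁₀ hτ₁ hτ₂ hN hW₀ hE p b (left_ne_zero_of_mul hne)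
    have hmem : (b.1 : Site (d + 1)) + ((bigRatio Lc (n + 1) : ℕ) : ℤ) • v ∈ pbox (towerTorus Lc M' (n + 1)) :=
      mem_pbox_of_quo_eq hL (bigRatio_dvd_towerTorus Lc hM' (n + 1)) ((towerEquiv Lc M' rs hrs (n + 1)).symm p').mem
        (by rw [quo_add_zsmul hL, h1, hp, quo_add_zsmul hL])
    exact ⟨(⟨_, hmem⟩, b.2), rfl, rfl⟩
  · obtain ⟨h1, _⟩ := readout_apply_ne_zero Lc Q hQ M' lev rs hrs hM' n hQ₁₀' hτ₁' hτ₂' hN' hW₀' hE' p' b' (left_ne_zero_of_mul hne)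
    have hmem : (b'.1 : Site (d + 1)) + ((bigRatio Lc (n + 1) : ℕ) : ℤ) • (-v) ∈ pbox (towerTorus Lc M (n + 1)) :=
      mem_pbox_of_quo_eq hL (bigRatio_dvd_towerTorus Lc hM (n + 1)) ((towerEquiv Lc M rs hrs (n + 1)).symm p).mem
        (by rw [quo_add_zsmul hL, h1, hp', quo_add_zsmul hL])
    refine ⟨(⟨_, hmem⟩, b'.2), ?_, rfl⟩
    show (b'.1 : Site (d + 1)) = (b'.1 : Site (d + 1)) + ((bigRatio Lc (n + 1) : ℕ) : ℤ) • (-v) + ((bigRatio Lc (n + 1) : ℕ) : ℤ) • v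
    rw [smul_neg, neg_add_cancel_right]
  · rw [readout_apply_corr Lc Q hQ hQt M M' lev rs hrs hM hM' n v hQ₁₀ hτ₁ hτ₂ hN hW₀ hE hQ₁₀' hτ₁' hτ₂' hN' hW₀' hE' hTW hTW' p p' hp b b' hR.1 hR.2]
    by_cases hz : (E' * (N' * W₀')⁻¹ * N') p' b' = 0
    · rw [hz, zero_mul, zero_mul]
    · have hz0 := hz
      rw [← readout_apply_corr Lc Q hQ hQt M M' lev rs hrs hM hM' n v hQ₁₀ hτ₁ hτ₂ hN hW₀ hE hQ₁₀' hτ₁' hτ₂' hN' hW₀' hE' hTW hTW' p p' hp b b' hR.1 hR.2] at hz0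
      obtain ⟨h1, h2⟩ := readout_apply_ne_zero Lc Q hQ M lev rs hrs hM n hQ₁₀ hτ₁ hτ₂ hN hW₀ hE p b hz0
      rw [hX b b' hR.1 hR.2 h1 h2]

/-- [folklore] **STUB P (P-b), VALUE FORM — THE TREE-GAUGE READ-OUTS OF TWO TOWERS AT CORRESPONDING FINEST SITES AGREE**: with `det (N·W₀) ≠ 0` and `det (N′·W₀′) ≠ 0` (leaf-06 G-2 on
each tower), the (D)-shaped equations `(N·W₀)·θ = −N·X`, `(N′·W₀′)·θ′ = −N′·X′`, finest sites `s′ = s + bigRatio•v`, and columns `X`, `X′` AGREEING ON CORRESPONDING BONDS INSIDE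
the big block of `s`: `Σ_x [x = s]·(E·θ)(towerEquiv x) = Σ_{x′} [x′ = s′]·(E′·θ′)(towerEquiv′ x′)` — v10's `hlve` word on the box `M` equals the same word on ANY other box
`M′` (e.g. the reference torus `M′ = fun _ => Lc`, one big block) fed with the translated column. -/
theorem treeGauge_readout_corr
    {Q₁₀ : Matrix (↥(pbox M) × Fin (d + 1)) (↥(pbox (towerTorus Lc M (n + 1))) × Fin (d + 1)) ℝ} (hQ₁₀ : Q₁₀ = compRowsG Lc Q M lev rs (n + 1))
    {τ₁ : Matrix (NParam Lc (fine Lc M) (fun k => rs (k + 1)) n) (↥(pbox (towerTorus Lc M (n + 1))) × Fin (d + 1)) ℝ}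
    (hτ₁ : τ₁ = bigP Lc (fine Lc M) (fun k => rs (k + 1)) (fun k => hrs (k + 1)) n)
    {τ₂ : Matrix (Res (toSite (rs 0)) Lc M) (↥(pbox M) × Fin (d + 1)) ℝ} (hτ₂ : τ₂ = combF Lc M (rs 0))
    {N : Matrix (NParam Lc M rs (n + 1)) (↥(pbox (towerTorus Lc M (n + 1))) × Fin (d + 1)) ℝ} (hN : N = Matrix.fromRows (τ₂ * Q₁₀) τ₁)
    {W₀ : Matrix (↥(pbox (towerTorus Lc M (n + 1))) × Fin (d + 1)) (NParam Lc M rs (n + 1)) ℝ} (hW₀ : W₀ = towerGen Lc M rs (n + 1))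
    {E : Matrix (NParam Lc M rs (n + 1)) (NParam Lc M rs (n + 1)) ℝ} (hE : E = towerEvalC Lc M rs hrs (n + 1))
    {Q₁₀' : Matrix (↥(pbox M') × Fin (d + 1)) (↥(pbox (towerTorus Lc M' (n + 1))) × Fin (d + 1)) ℝ} (hQ₁₀' : Q₁₀' = compRowsG Lc Q M' lev rs (n + 1))
    {τ₁' : Matrix (NParam Lc (fine Lc M') (fun k => rs (k + 1)) n) (↥(pbox (towerTorus Lc M' (n + 1))) × Fin (d + 1)) ℝ}
    (hτ₁' : τ₁' = bigP Lc (fine Lc M') (fun k => rs (k + 1)) (fun k => hrs (k + 1)) n)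
    {τ₂' : Matrix (Res (toSite (rs 0)) Lc M') (↥(pbox M') × Fin (d + 1)) ℝ} (hτ₂' : τ₂' = combF Lc M' (rs 0))
    {N' : Matrix (NParam Lc M' rs (n + 1)) (↥(pbox (towerTorus Lc M' (n + 1))) × Fin (d + 1)) ℝ} (hN' : N' = Matrix.fromRows (τ₂' * Q₁₀') τ₁')
    {W₀' : Matrix (↥(pbox (towerTorus Lc M' (n + 1))) × Fin (d + 1)) (NParam Lc M' rs (n + 1)) ℝ} (hW₀' : W₀' = towerGen Lc M' rs (n + 1))
    {E' : Matrix (NParam Lc M' rs (n + 1)) (NParam Lc M' rs (n + 1)) ℝ} (hE' : E' = towerEvalC Lc M' rs hrs (n + 1))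
    (hTW : (N * W₀).det ≠ 0) (hTW' : (N' * W₀').det ≠ 0)
    {θ : NParam Lc M rs (n + 1) → ℝ} {θ' : NParam Lc M' rs (n + 1) → ℝ}
    {X : ↥(pbox (towerTorus Lc M (n + 1))) × Fin (d + 1) → ℝ} {X' : ↥(pbox (towerTorus Lc M' (n + 1))) × Fin (d + 1) → ℝ}
    (hθ : (N * W₀) *ᵥ θ = -(N *ᵥ X)) (hθ' : (N' * W₀') *ᵥ θ' = -(N' *ᵥ X'))
    (s : ↥(pbox (towerTorus Lc M (n + 1)))) (s' : ↥(pbox (towerTorus Lc M' (n + 1))))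
    (hs : (s' : Site (d + 1)) = (s : Site (d + 1)) + ((bigRatio Lc (n + 1) : ℕ) : ℤ) • v)
    (hX : ∀ (b : ↥(pbox (towerTorus Lc M (n + 1))) × Fin (d + 1)) (b' : ↥(pbox (towerTorus Lc M' (n + 1))) × Fin (d + 1)),
      (b'.1 : Site (d + 1)) = (b.1 : Site (d + 1)) + ((bigRatio Lc (n + 1) : ℕ) : ℤ) • v → b'.2 = b.2 →
      quo (bigRatio Lc (n + 1)) (b.1 : Site (d + 1)) = quo (bigRatio Lc (n + 1)) (s : Site (d + 1)) →
      quo (bigRatio Lc (n + 1)) ((b.1 : Site (d + 1)) + unitVec b.2) = quo (bigRatio Lc (n + 1)) (s : Site (d + 1)) → X b = X' b') :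
    (∑ x : Res (bigRoot Lc rs (n + 1)) (bigRatio Lc (n + 1)) (towerTorus Lc M (n + 1)),
        (if (x.1 : ↥(pbox (towerTorus Lc M (n + 1)))) = s then (E *ᵥ θ) (towerEquiv Lc M rs hrs (n + 1) x) else 0))
      = ∑ x' : Res (bigRoot Lc rs (n + 1)) (bigRatio Lc (n + 1)) (towerTorus Lc M' (n + 1)),
        (if (x'.1 : ↥(pbox (towerTorus Lc M' (n + 1)))) = s' then (E' *ᵥ θ') (towerEquiv Lc M' rs hrs (n + 1) x') else 0) := by
  have hLc : 0 < Lc := Nat.pos_of_ne_zero (NeZero.ne Lc)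
  have hL : 0 < bigRatio Lc (n + 1) := bigRatio_pos Lc hLc (n + 1)
  rw [mulVec_eq_neg_readout_mulVec (N * W₀) E N (isUnit_iff_ne_zero.mpr hTW) hθ, mulVec_eq_neg_readout_mulVec (N' * W₀') E' N' (isUnit_iff_ne_zero.mpr hTW') hθ']
  refine sum_eq_sum_of_rel _ _ (fun x x' => x'.site = x.site + ((bigRatio Lc (n + 1) : ℕ) : ℤ) • v)
    (fun x x' y' hx hy => (Res.ext_iff' _ _).2 (hx.trans hy.symm))
    (fun x y x' hx hy => (Res.ext_iff' _ _).2 (add_right_cancel (hx.symm.trans hy)))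
    (fun x hne => ?_) (fun x' hne => ?_) (fun x x' hxx' => ?_)
  · -- a nonzero term sits at the site `s`; its partner sits at `s'`
    have hxs : (x.1 : ↥(pbox (towerTorus Lc M (n + 1)))) = s := by by_contra h; exact hne (if_neg h)
    have hsite : x.site = (s : Site (d + 1)) := congrArg Subtype.val hxs
    have hmem : x.site + ((bigRatio Lc (n + 1) : ℕ) : ℤ) • v ∈ pbox (towerTorus Lc M' (n + 1)) := by rw [hsite, ← hs]; exact s'.2
    exact ⟨⟨⟨_, hmem⟩, (ne_rootOf_add_zsmul_iff hL _ v).2 x.not_root⟩, rfl⟩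
  · have hxs : (x'.1 : ↥(pbox (towerTorus Lc M' (n + 1)))) = s' := by by_contra h; exact hne (if_neg h)
    have hsite : x'.site = (s' : Site (d + 1)) := congrArg Subtype.val hxs
    have hmem : x'.site + ((bigRatio Lc (n + 1) : ℕ) : ℤ) • (-v) ∈ pbox (towerTorus Lc M (n + 1)) := by
      rw [hsite, hs, smul_neg, add_neg_cancel_right]; exact s.2
    refine ⟨⟨⟨_, hmem⟩, (ne_rootOf_add_zsmul_iff hL _ (-v)).2 x'.not_root⟩, ?_⟩
    show x'.site = x'.site + ((bigRatio Lc (n + 1) : ℕ) : ℤ) • (-v) + ((bigRatio Lc (n + 1) : ℕ) : ℤ) • v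
    rw [smul_neg, neg_add_cancel_right]
  · -- partners: the site conditions agree, and so do the read-outs fed with columns agreeing inside the block
    have hsx : x.site = (s : Site (d + 1)) ↔ (x.1 : ↥(pbox (towerTorus Lc M (n + 1)))) = s := ⟨fun h => Subtype.ext h, fun h => congrArg Subtype.val h⟩
    have hsx' : x'.site = (s' : Site (d + 1)) ↔ (x'.1 : ↥(pbox (towerTorus Lc M' (n + 1)))) = s' := ⟨fun h => Subtype.ext h, fun h => congrArg Subtype.val h⟩
    by_cases hxs : (x.1 : ↥(pbox (towerTorus Lc M (n + 1)))) = s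
    · have hxs' : (x'.1 : ↥(pbox (towerTorus Lc M' (n + 1)))) = s' := hsx'.1 (by rw [hxx', hsx.2 hxs, hs])
      rw [if_pos hxs, if_pos hxs', Pi.neg_apply, Pi.neg_apply]
      have hp : ((towerEquiv Lc M' rs hrs (n + 1)).symm (towerEquiv Lc M' rs hrs (n + 1) x')).site
          = ((towerEquiv Lc M rs hrs (n + 1)).symm (towerEquiv Lc M rs hrs (n + 1) x)).site + ((bigRatio Lc (n + 1) : ℕ) : ℤ) • v := by
        rw [Equiv.symm_apply_apply, Equiv.symm_apply_apply]; exact hxx'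
      rw [readout_mulVec_corr Lc Q hQ hQt M M' lev rs hrs hM hM' n v hQ₁₀ hτ₁ hτ₂ hN hW₀ hE hQ₁₀' hτ₁' hτ₂' hN' hW₀' hE' hTW hTW' _ _ hp X X'
        (fun b b' h1 h2 h3 h4 => hX b b' h1 h2 (by rw [h3, Equiv.symm_apply_apply, hsx.2 hxs]) (by rw [h4, Equiv.symm_apply_apply, hsx.2 hxs]))]
    · have hxs' : ¬ (x'.1 : ↥(pbox (towerTorus Lc M' (n + 1)))) = s' := fun h =>
        hxs (hsx.1 (add_right_cancel ((hxx'.symm.trans (hsx'.2 h)).trans hs)))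
      rw [if_neg hxs, if_neg hxs']

end Inverse

end Summit.QuantumFields.BalabanUV.Beta.FP.TorusNestedReadoutReference

end
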